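import Summits.QuantumAdvantage.AdviceFreeQNC0.CleanGapStrategies
import Summits.QuantumAdvantage.AdviceFreeQNC0.WalkTransport
import Summits.QuantumAdvantage.AdviceFreeQNC0.WalkCoreBasics
import HarnessLib

/-!
# Cell qa-qnc0 (p = 3 line, rung R1): WINDOW-LOCAL strategies of any degree win at most `1/3 + 2^ℓ/(3·2^N)`

Planner qa-qnc0-p1 g15, `LINE-R1.md` / `Sketch18.lean` §6, rung **R1 `WindowLocalTwoThirds3`** (statement VERBATIM),
PROVED with `c = 1`: a bell strategy `z = tGuess x ⊕ w(x)` that rings bells only at the cuts `k ∈ [a, a+ℓ)` and whose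
bells read only the window's interior bonds `x_j`, `a+1 ≤ j ≤ a+ℓ-2`, satisfies
`3·#{x odd : Rel x (z x)} ≤ 2^N + 2^ℓ` — NO degree hypothesis.

**Proof — the TWO-SIDED GAP LEMMA in u-coordinates** (companion of qn-prover g3's `CleanGapStrategies.lean`, where the
window is the UNREAD part; here the window is the ONLY read part).  By `WalkTransport.rel_iff_ringWinU` the
transported strategy is the selector `y_g(u) = w(xOfU u)_g` (the canonical guesses cancel), which selects only cuts
`g ∈ [p, p+L]` (`p = a`, `L = ℓ - 1`) and reads only the window bits `u_p … u_{p+L-1}` (`xOfU u j` depends on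
`u_{j-1}, u_j`).  Write `u = a ++ v ++ b` (`glue3`, `|a| = p`, `|v| = L`, `|b| = q`).  A selected cut `g ∈ [p, p+L]` has
character `c + g + |u| + W_g(u) = (c + g + |v| + W_{g-p}(v)) + (2|a| + |b|)` (`WindowLocal.ringWinU_glue3_iff`): the
outside enters only through the UNIFORM shift `s = 2|a| + |b| (mod 3)`.  For each window content `v`, each selected cut's
character is non-zero for exactly two values of `s`, so the three counts sum to an even number and some residue `s₀`
LOSES (`exists_midCount_even`); the class `{(a,b) : 2|a| + |b| ≡ s₀}` is in bijection (complement `a`, append) with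
`{t ∈ {0,1}^{p+q} : |t| ≡ s₀ + p}`, of size `≥ (2^{p+q} - 2)/3` (`three_mul_card_class_add_two_ge`).  Hence
`3·#{(a,b) : WIN} ≤ 2·2^{p+q} + 2` per window content and, summing over the `2^L` contents (Fubini
`card_filter_eq_sum_mid`), `3·#WIN ≤ 2·2ⁿ + 2^{L+1} = 2^N + 2^ℓ`.  (`ℓ = 0`: no bells, no wins.)

WHAT THIS IS NOT: nothing on strategies that read outside their betting window (that is the open crux `OneBellDWB3` /
E3 of ROUND-14); the constant `c = 1` is not claimed sharp; separation NOT moved.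
-/

noncomputable section

namespace Summit.QuantumAdvantage.AdviceFreeQNC0

open Finset Literature.Computability.QuantumComplexity Literature.Computability.QuantumComplexity.RingHLF
open Literature.Computability.MetaComplexity

/-- **R1 `WindowLocalTwoThirds3`** (qa-qnc0-p1 Sketch18 §6, verbatim) — window-local strategies, ANY degree: a strategy
that rings bells only at cuts `k ∈ [a, a+ℓ)` and whose bells depend only on the window's interior bonds `x_j`,
`a+1 ≤ j ≤ a+ℓ-2`, wins on at most `2^N/3 + O(2^ℓ)` inputs of the odd class. -/
def WindowLocalTwoThirds3 : Prop :=
  ∃ c : ℕ, ∀ (N a ℓ : ℕ), 3 ≤ N → a + ℓ ≤ N →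
    ∀ w : (Fin N → Bool) → Fin N → Bool,
      (∀ x k, w x k = true → a ≤ k.val ∧ k.val < a + ℓ) →
      (∀ x x' : Fin N → Bool, (∀ j : Fin N, a + 1 ≤ j.val → j.val + 2 ≤ a + ℓ → x j = x' j) → w x = w x') →
      3 * (univ.filter fun x : Fin N → Bool =>
          (univ.filter fun b : Fin N => x b = false).card % 2 = 1 ∧
            RingHLF.Rel x (fun k => xor (tGuess x k) (w x k))).card ≤ 2 ^ N + c * 2 ^ ℓ

namespace WindowLocal

variable {p L q : ℕ}

/-! ### The window block of a glued input -/

/-- The middle block of `a ++ v ++ b` is `v`. -/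
theorem glue3_mid (a : Fin p → Bool) (v : Fin L → Bool) (b : Fin q → Bool) (i : Fin (p + L + q))
    (h1 : p ≤ i.val) (h2 : i.val < p + L) : glue3 a v b i = v ⟨i.val - p, by omega⟩ := by
  have hi : Fin.castAdd q (Fin.natAdd p (⟨i.val - p, by omega⟩ : Fin L)) = i := by
    ext; simp only [Fin.val_castAdd, Fin.val_natAdd]; omega
  conv_lhs => rw [← hi]
  unfold glue3
  rw [Fin.append_left, Fin.append_right]

/-- Prefix weights at cuts inside the window: the whole prefix block plus a prefix of the window. -/
theorem wtPrefix_glue3_mid (a : Fin p → Bool) (v : Fin L → Bool) (b : Fin q → Bool) {g : ℕ}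
    (h1 : p ≤ g) (h2 : g ≤ p + L) : wtPrefix (glue3 a v b) g = wt a + wtPrefix v (g - p) := by
  unfold glue3
  rw [wtPrefix_append_of_le _ _ h2, wtPrefix_append_of_ge _ _ h1]

/-- The backward chart at an interior bond of the window reads only the window block. -/
theorem xOfU_glue3_window (a₁ a₂ : Fin p → Bool) (v : Fin L → Bool) (b₁ b₂ : Fin q → Bool)
    (j : Fin (p + L + q + 1)) (h1 : p + 1 ≤ j.val) (h2 : j.val + 1 ≤ p + L) :
    xOfU (glue3 a₁ v b₁) j = xOfU (glue3 a₂ v b₂) j := by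
  have hj0 : j.val ≠ 0 := by omega
  have e1 : ∀ (a : Fin p → Bool) (b : Fin q → Bool), uExt (glue3 a v b) j.val = v ⟨j.val - p, by omega⟩ := by
    intro a b
    unfold uExt
    rw [dif_pos (show j.val < p + L + q by omega)]
    exact glue3_mid a v b _ (by show p ≤ j.val; omega) (by show j.val < p + L; omega)
  have e2 : ∀ (a : Fin p → Bool) (b : Fin q → Bool),
      uExt (glue3 a v b) (j.val - 1) = v ⟨j.val - 1 - p, by omega⟩ := by
    intro a b
    unfold uExt
    rw [dif_pos (show j.val - 1 < p + L + q by omega)]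
    exact glue3_mid a v b _ (by show p ≤ j.val - 1; omega) (by show j.val - 1 < p + L; omega)
  unfold xOfU
  rw [if_neg hj0, if_neg hj0, e1, e1, e2, e2]

/-! ### The characters with the outside weights as one parameter -/

/-- The walk character of a window cut `g ∈ [p, p+L]` on `a ++ v ++ b`, with the outside contribution
`2|a| + |b|` replaced by the parameter `s`. -/
def midChar (p c : ℕ) (v : Fin L → Bool) (g s : ℕ) : ℕ := c + g + (wt v + wtPrefix v (g - p)) + s

/-- The selectors read off the window block (outside blocks filled with zeros). -/
def midSel (y : Fin (p + L + q + 1) → (Fin (p + L + q) → Bool) → Bool) (v : Fin L → Bool)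
    (g : Fin (p + L + q + 1)) : Bool :=
  y g (glue3 (fun _ : Fin p => false) v (fun _ : Fin q => false))

/-- `N(s)` = number of selected cuts whose character with outside parameter `s` is non-zero mod `3`. -/
def midCount (y : Fin (p + L + q + 1) → (Fin (p + L + q) → Bool) → Bool) (c : ℕ) (v : Fin L → Bool)
    (s : ℕ) : ℕ :=
  (univ.filter fun g : Fin (p + L + q + 1) => midSel y v g = true ∧ midChar p c v g.val s % 3 ≠ 0).card

/-- The character mod `3` depends on the parameter only mod `3`. -/
theorem midChar_mod (p c : ℕ) (v : Fin L → Bool) (g s : ℕ) :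
    midChar p c v g s % 3 = midChar p c v g (s % 3) % 3 := by
  unfold midChar; omega

/-- Hence `N(s) = N(s mod 3)`. -/
theorem midCount_mod (y : Fin (p + L + q + 1) → (Fin (p + L + q) → Bool) → Bool) (c : ℕ)
    (v : Fin L → Bool) (s : ℕ) : midCount y c v s = midCount y c v (s % 3) := by
  unfold midCount
  congr 1
  refine Finset.filter_congr fun g _ => ?_
  rw [midChar_mod p c v g.val s]

/-- For every cut, EXACTLY two of the three parameter values give a non-zero character. -/
theorem sum_range_three_midChar_ne (p c : ℕ) (v : Fin L → Bool) (g : ℕ) :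
    ∑ s ∈ range 3, (if midChar p c v g s % 3 ≠ 0 then 1 else 0) = 2 := by
  rw [Finset.sum_range_succ, Finset.sum_range_succ, Finset.sum_range_succ, Finset.sum_range_zero]
  unfold midChar
  split_ifs <;> omega

/-! ### The win bit on a glued input -/

variable (c : ℕ) (y : Fin (p + L + q + 1) → (Fin (p + L + q) → Bool) → Bool)

/-- **The win bit through the outside weights.**  If the strategy selects only window cuts `g ∈ [p, p+L]` and reads
only the window block, then on `a ++ v ++ b` it wins iff `N(2|a| + |b|)` is odd. -/
theorem ringWinU_glue3_iff
    (hsel : ∀ g : Fin (p + L + q + 1), (g.val < p ∨ p + L < g.val) → ∀ u, y g u = false)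
    (hloc : ∀ (g : Fin (p + L + q + 1)) (a a' : Fin p → Bool) (v : Fin L → Bool) (b b' : Fin q → Bool),
      y g (glue3 a v b) = y g (glue3 a' v b'))
    (a : Fin p → Bool) (v : Fin L → Bool) (b : Fin q → Bool) :
    ringWinU c y (glue3 a v b) = true ↔ midCount y c v (2 * wt a + wt b) % 2 = 1 := by
  unfold ringWinU midCount
  rw [decide_eq_true_iff]
  have hset : (univ.filter fun g : Fin (p + L + q + 1) =>
      y g (glue3 a v b) = true ∧ (c + g.val + walkExp (glue3 a v b) g.val) % 3 ≠ 0) =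
      univ.filter fun g : Fin (p + L + q + 1) =>
        midSel y v g = true ∧ midChar p c v g.val (2 * wt a + wt b) % 3 ≠ 0 := by
    refine Finset.filter_congr fun g _ => ?_
    have hs : y g (glue3 a v b) = midSel y v g := hloc g a (fun _ => false) v b (fun _ => false)
    -- a selected cut lies in the window
    have hin : midSel y v g = true → (p ≤ g.val ∧ g.val ≤ p + L) := by
      intro h1
      by_contra hcon
      have hf := hsel g (by omega) (glue3 (fun _ : Fin p => false) v (fun _ : Fin q => false))
      unfold midSel at h1
      rw [hf] at h1
      exact Bool.false_ne_true h1
    -- inside the window the true character is `midChar` at `s = 2|a| + |b|`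
    have hchar : (p ≤ g.val ∧ g.val ≤ p + L) →
        c + g.val + walkExp (glue3 a v b) g.val = midChar p c v g.val (2 * wt a + wt b) := by
      intro hg
      unfold walkExp midChar
      rw [wtPrefix_glue3_mid a v b hg.1 hg.2, wt_glue3]
      ring
    rw [hs]
    constructor
    · rintro ⟨h1, h2⟩
      exact ⟨h1, by rwa [← hchar (hin h1)]⟩
    · rintro ⟨h1, h2⟩
      exact ⟨h1, by rwa [hchar (hin h1)]⟩
  rw [hset]

/-! ### At most two of the three outside residues win -/

/-- **The parity obstruction.**  `N(0) + N(1) + N(2) = 2·#selected` is even, so some `N(s₀)` (`s₀ < 3`) is even: on every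
outside content `(a, b)` with `2|a| + |b| ≡ s₀ (mod 3)` the strategy loses. -/
theorem exists_midCount_even (v : Fin L → Bool) : ∃ s₀, s₀ < 3 ∧ midCount y c v s₀ % 2 = 0 := by
  set S := univ.filter fun g : Fin (p + L + q + 1) => midSel y v g = true with hS
  have hcount : ∀ s, midCount y c v s = ∑ g ∈ S, (if midChar p c v g.val s % 3 ≠ 0 then 1 else 0) := by
    intro s
    unfold midCount
    rw [hS, Finset.sum_filter, Finset.card_filter]
    refine Finset.sum_congr rfl fun g _ => ?_
    by_cases h1 : midSel y v g = true <;> by_cases h2 : midChar p c v g.val s % 3 ≠ 0 <;> simp [h1, h2]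
  have hsum : ∑ s ∈ range 3, midCount y c v s = S.card * 2 := by
    simp_rw [hcount]
    rw [Finset.sum_comm, Finset.sum_congr rfl fun g _ => sum_range_three_midChar_ne p c v g.val,
      Finset.sum_const, smul_eq_mul]
  rw [Finset.sum_range_succ, Finset.sum_range_succ, Finset.sum_range_succ, Finset.sum_range_zero] at hsum
  by_contra hcon
  simp only [not_exists, not_and] at hcon
  have h0 := hcon 0 (by norm_num)
  have h1 := hcon 1 (by norm_num)
  have h2 := hcon 2 (by norm_num)
  omega

/-! ### The signed residue classes of the outside cube -/

/-- The outside contents `(a, b)` with `2|a| + |b| ≡ r (mod 3)` are at least as many as the words `t ∈ {0,1}^{p+q}` with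
`|t| ≡ r + p (mod 3)`: `t = ā ++ b ↦ (a, b)` (complementing `a` turns `2|a| ≡ -|a|` into `|ā| - p`). -/
theorem card_class_le_card_signedClass (r : ℕ) :
    (univ.filter fun t : Fin (p + q) → Bool => wt t % 3 = (r + p) % 3).card ≤
      ((univ ×ˢ univ).filter fun ab : (Fin p → Bool) × (Fin q → Bool) =>
        (2 * wt ab.1 + wt ab.2) % 3 = r % 3).card := by
  refine Finset.card_le_card_of_injOn
    (fun t => ((fun i => !t (Fin.castAdd q i)), fun i => t (Fin.natAdd p i))) ?_ ?_
  · intro t ht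
    rw [Finset.mem_coe, mem_filter] at ht
    rw [Finset.mem_coe, mem_filter]
    refine ⟨mem_product.mpr ⟨mem_univ _, mem_univ _⟩, ?_⟩
    simp only
    have hsplit : wt t = wt (fun i => t (Fin.castAdd q i)) + wt (fun i => t (Fin.natAdd p i)) := by
      rw [← wt_append]
      congr 1
      funext i
      induction i using Fin.addCases with
      | left i => rw [Fin.append_left]
      | right i => rw [Fin.append_right]
    have hle : wt (fun i => t (Fin.castAdd q i)) ≤ p := by
      unfold wt
      exact (card_filter_le _ _).trans (by simp)
    rw [wt_not]
    omega
  · intro t₁ _ t₂ _ h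
    simp only [Prod.mk.injEq] at h
    obtain ⟨ha, hb⟩ := h
    funext i
    induction i using Fin.addCases with
    | left i =>
      have := congrArg (fun b => !b) (congrFun ha i)
      simpa using this
    | right i => exact congrFun hb i

/-- Every signed residue class of the outside cube has at least `(2^{p+q} - 2)/3` elements. -/
theorem three_mul_card_signedClass_add_two_ge (r : ℕ) :
    2 ^ (p + q) ≤ 3 * ((univ ×ˢ univ).filter fun ab : (Fin p → Bool) × (Fin q → Bool) =>
        (2 * wt ab.1 + wt ab.2) % 3 = r % 3).card + 2 := by
  have h1 := three_mul_card_class_add_two_ge (p + q) (r + p)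
  have h2 := card_class_le_card_signedClass (p := p) (q := q) r
  omega

/-! ### The fibre bound and Fubini -/

/-- On a fibre `{a ++ v ++ b : (a, b)}` (window content `v` fixed) the strategy wins on at most `2^{p+q} - (2^{p+q}-2)/3`
outside contents: `3·#{(a,b) : WIN(a ++ v ++ b)} ≤ 2·2^{p+q} + 2`. -/
theorem three_mul_card_win_fibre_le
    (hsel : ∀ g : Fin (p + L + q + 1), (g.val < p ∨ p + L < g.val) → ∀ u, y g u = false)
    (hloc : ∀ (g : Fin (p + L + q + 1)) (a a' : Fin p → Bool) (v : Fin L → Bool) (b b' : Fin q → Bool),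
      y g (glue3 a v b) = y g (glue3 a' v b'))
    (v : Fin L → Bool) :
    3 * ((univ ×ˢ univ).filter fun ab : (Fin p → Bool) × (Fin q → Bool) =>
        ringWinU c y (glue3 ab.1 v ab.2) = true).card ≤ 2 * 2 ^ (p + q) + 2 := by
  obtain ⟨s₀, hs₀, heven⟩ := exists_midCount_even c y v
  have hsub : ((univ ×ˢ univ).filter fun ab : (Fin p → Bool) × (Fin q → Bool) =>
        ringWinU c y (glue3 ab.1 v ab.2) = true) ⊆
      (univ ×ˢ univ).filter fun ab : (Fin p → Bool) × (Fin q → Bool) =>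
        ¬ ((2 * wt ab.1 + wt ab.2) % 3 = s₀ % 3) := by
    intro ab hab
    rw [mem_filter] at hab ⊢
    refine ⟨hab.1, fun hclass => ?_⟩
    have hv := hab.2
    rw [ringWinU_glue3_iff c y hsel hloc, midCount_mod, hclass, Nat.mod_eq_of_lt hs₀, heven] at hv
    exact absurd hv (by norm_num)
  have hcard := Finset.card_le_card hsub
  have hcompl : ((univ ×ˢ univ).filter fun ab : (Fin p → Bool) × (Fin q → Bool) =>
        (2 * wt ab.1 + wt ab.2) % 3 = s₀ % 3).card +
      ((univ ×ˢ univ).filter fun ab : (Fin p → Bool) × (Fin q → Bool) =>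
        ¬ ((2 * wt ab.1 + wt ab.2) % 3 = s₀ % 3)).card = 2 ^ (p + q) := by
    rw [Finset.card_filter_add_card_filter_not, Finset.card_product, Finset.card_univ, Finset.card_univ,
      Fintype.card_fun, Fintype.card_fun, Fintype.card_bool, Fintype.card_fin, Fintype.card_fin, pow_add]
  have hclass := three_mul_card_signedClass_add_two_ge (p := p) (q := q) s₀
  omega

/-- Fubini with the window innermost turned outermost: a count over `{0,1}^{p+L+q}` is the sum over the window contents
`v` of the counts over the outside contents `(a, b)`. -/
theorem card_filter_eq_sum_mid (P : (Fin (p + L + q) → Bool) → Prop) [DecidablePred P] :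
    (univ.filter fun u : Fin (p + L + q) → Bool => P u).card =
      ∑ v : Fin L → Bool, ((univ ×ˢ univ).filter fun ab : (Fin p → Bool) × (Fin q → Bool) =>
        P (glue3 ab.1 v ab.2)).card := by
  rw [card_filter_eq_sum_glue3]
  simp_rw [Finset.card_filter]
  rw [Finset.sum_congr rfl fun a _ => Finset.sum_comm, Finset.sum_comm]
  refine Finset.sum_congr rfl fun v _ => ?_
  rw [Finset.sum_product]

/-- **THE TWO-SIDED GAP LEMMA.**  A walk strategy on `n = p + L + q` bits that selects only the window cuts `[p, p+L]` and
reads only the window bits wins on at most `(2/3)(2ⁿ + 2^L)` inputs: `3·#WIN ≤ 2·2ⁿ + 2·2^L`. -/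
theorem ringWinU_window_le
    (hsel : ∀ g : Fin (p + L + q + 1), (g.val < p ∨ p + L < g.val) → ∀ u, y g u = false)
    (hloc : ∀ (g : Fin (p + L + q + 1)) (a a' : Fin p → Bool) (v : Fin L → Bool) (b b' : Fin q → Bool),
      y g (glue3 a v b) = y g (glue3 a' v b')) :
    3 * (univ.filter fun u : Fin (p + L + q) → Bool => ringWinU c y u = true).card ≤
      2 * 2 ^ (p + L + q) + 2 * 2 ^ L := by
  rw [card_filter_eq_sum_mid, Finset.mul_sum]
  calc ∑ v : Fin L → Bool, 3 * ((univ ×ˢ univ).filter fun ab : (Fin p → Bool) × (Fin q → Bool) =>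
          ringWinU c y (glue3 ab.1 v ab.2) = true).card
      ≤ ∑ _v : Fin L → Bool, (2 * 2 ^ (p + q) + 2) :=
        Finset.sum_le_sum fun v _ => three_mul_card_win_fibre_le c y hsel hloc v
    _ = 2 ^ L * (2 * 2 ^ (p + q) + 2) := by
        rw [Finset.sum_const, Finset.card_univ, Fintype.card_fun, Fintype.card_bool, Fintype.card_fin,
          smul_eq_mul]
    _ = 2 * 2 ^ (p + L + q) + 2 * 2 ^ L := by ring

end WindowLocal

/-! ### R1 -/

/-- **R1 `WindowLocalTwoThirds3` — PROVED with `c = 1`**: window-local bell strategies of ANY degree win on at most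
`(2^N + 2^ℓ)/3` patterns of the odd class. -/
theorem windowLocalTwoThirds3 : WindowLocalTwoThirds3 := by
  classical
  refine ⟨1, fun N a ℓ hN haℓ w hsel hview => ?_⟩
  obtain ⟨n, rfl⟩ : ∃ n, N = n + 1 := ⟨N - 1, by omega⟩
  -- the transported selector `y_g(u) = w(xOfU u)_g`
  set z : (Fin (n + 1) → Bool) → (Fin (n + 1) → Bool) := fun x k => xor (tGuess x k) (w x k) with hz
  set y : Fin (n + 1) → (Fin n → Bool) → Bool := fun g u => w (xOfU u) g with hy
  have hy' : (fun (g : Fin (n + 1)) (u : Fin n → Bool) => xor (z (xOfU u) g) (tGuess (xOfU u) g)) = y := by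
    funext g u
    simp only [hz, hy]
    generalize tGuess (xOfU u) g = t
    generalize w (xOfU u) g = d
    cases t <;> cases d <;> rfl
  -- the odd class injects into the walk wins of `y`
  have hinj : (univ.filter fun x : Fin (n + 1) → Bool =>
        (univ.filter fun b : Fin (n + 1) => x b = false).card % 2 = 1 ∧ Rel x (z x)).card ≤
      (univ.filter fun u : Fin n → Bool => ringWinU (n + 2) y u = true).card := by
    refine Finset.card_le_card_of_injOn uVec ?_ ?_
    · intro x hx
      rw [Finset.mem_coe, mem_filter] at hx
      rw [Finset.mem_coe, mem_filter]
      refine ⟨mem_univ _, ?_⟩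
      have h := (rel_iff_ringWinU (by omega) x hx.2.1 z).1 hx.2.2
      rwa [hy'] at h
    · intro x₁ hx₁ x₂ hx₂ h
      rw [Finset.mem_coe, mem_filter] at hx₁ hx₂
      rw [← xOfU_uVec (by omega) x₁ hx₁.2.1, ← xOfU_uVec (by omega) x₂ hx₂.2.1, h]
  rcases Nat.eq_zero_or_pos ℓ with hℓ | hℓ
  · -- no bells at all: nobody wins on the odd class
    subst hℓ
    have hno : ∀ g u, y g u = false := by
      intro g u
      simp only [hy]
      by_contra h
      rw [Bool.not_eq_false] at h
      have := hsel _ _ h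
      omega
    have hempty : (univ.filter fun u : Fin n → Bool => ringWinU (n + 2) y u = true).card = 0 := by
      rw [Finset.card_eq_zero, Finset.filter_eq_empty_iff]
      intro u _
      unfold ringWinU
      rw [decide_eq_true_iff]
      have : (univ.filter fun g : Fin (n + 1) =>
          y g u = true ∧ (n + 2 + g.val + walkExp u g.val) % 3 ≠ 0) = ∅ := by
        rw [Finset.filter_eq_empty_iff]
        intro g _ hg
        rw [hno g u] at hg
        exact Bool.false_ne_true hg.1
      rw [this, Finset.card_empty]
      omega
    simp only [hz] at hinj
    have h2n : 0 < 2 ^ (n + 1) := Nat.two_pow_pos _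
    omega
  · -- `ℓ = L + 1`, `N = a + L + q + 1`: the two-sided gap lemma with the window `[a, a+L)` of bits
    obtain ⟨L, rfl⟩ : ∃ L, ℓ = L + 1 := ⟨ℓ - 1, by omega⟩
    obtain ⟨q, hq⟩ : ∃ q, n = a + L + q := ⟨n - a - L, by omega⟩
    subst hq
    have hsel' : ∀ g : Fin (a + L + q + 1), (g.val < a ∨ a + L < g.val) → ∀ u, y g u = false := by
      intro g hg u
      simp only [hy]
      by_contra h
      rw [Bool.not_eq_false] at h
      have := hsel _ _ h
      omega
    have hloc' : ∀ (g : Fin (a + L + q + 1)) (a₁ a₂ : Fin a → Bool) (v : Fin L → Bool) (b₁ b₂ : Fin q → Bool),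
        y g (glue3 a₁ v b₁) = y g (glue3 a₂ v b₂) := by
      intro g a₁ a₂ v b₁ b₂
      simp only [hy]
      exact congrFun (hview _ _ fun j h1 h2 =>
        WindowLocal.xOfU_glue3_window a₁ a₂ v b₁ b₂ j h1 (by omega)) g
    have hW := WindowLocal.ringWinU_window_le (a + L + q + 2) y hsel' hloc'
    have hpow : 2 * 2 ^ (a + L + q) + 2 * 2 ^ L = 2 ^ (a + L + q + 1) + 1 * 2 ^ (L + 1) := by ring
    simp only [hz] at hinj
    omega

end Summit.QuantumAdvantage.AdviceFreeQNC0

end
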